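import Summits.BirchSwinnertonDyer.BirchSwinnertonDyer.Theorems.ByReductionTypeAtTwoSupersingularFlatCapstoneCongruences
import Summits.BirchSwinnertonDyer.BirchSwinnertonDyer.Theorems.ThetaPartnerAtTwoSignedKatoUpToAtTwoKatoBKCoreKZLit
import HarnessLib

/-!
# Crux `SupersingularRankZeroAtTwo` (K4, item stmt-BirchSwinnertonDyer-19097), line `odd_blind_package` v2.20 (39efd4f3),
# stub 2/5 `stub_flatPackage : FlatZetaPackageAtTwo` — FILE C3a of hand «hF3-CAP»: THE CORE OF THE F3 CAPSTONE — Kato's lifts and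
# their levelwise congruences for the family of record, from the displayed (KZ) family and cusp family

Seat `bsd-2adic-t42` GEN 52 (pen GEN 41 SUMMON 20260831T234826Z; director-bsd g27 (1009)(a)/(1010)(a); LEAD ss-1 GEN 26 notes N1–N3).
HONEST FRAMING (D-0054): THEOREMS ONLY — no definition, no named fact, no instance, no notation, no `sorry`.  CONSUMER: no Kato value
is computed, no logarithm unfolded, no modular symbol evaluated; every analytic input is a displayed hypothesis in the tree's exact
tokens or a tree theorem cited by name.  Capstone helpers toward stub 2; they close NO stub by themselves (stub 2 closes only when the
LEAD's v2.21 glue lands AND its displayed hypotheses are discharged or re-homed); 19097 stays OPEN on its 5 registered stubs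
(v2.20 39efd4f3); nothing booked; BSD₂ is proved for no supersingular curve and BSD for no curve by any of this; typed ≠ proved.
`bears_on: K4 (19097) (8) F3 / v2.21`.  Everything here is at `p = 2`.

## What

* §1 ★ `hV_of_KZ` — THE (N2) BRIDGE: the f-block's PIN on the localisation `L` (`toZModPow k (L x Q) = tatePairingPk n k (proj_n x) Q`)
  turns the (KZ) clause of `Kato2004.exists_eulerSystem_expStar_tatePairing_values_two` (layer Tate pairings of `Cor z_{2^{n+2}}` with formal
  points = traces of `log_ω · x_{n+2}`) into E5's (C6)-shaped values `hV` for `w := L s`, `s` the Λ-adic lift of Kato's `z`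
  (`PadicInt.ext_of_toZModPow`, `toLoc_symm_mem_kernel_iff`, `KatoBK.ptLogΩ_toLoc_symm_eq`; transport `c n = Φ(d₀ n)`, `Φ(g₀ʲ•P) = gʲ•Φ P`).
* §2 ★★ `exists_lifts_levelCongruences_of_katoFamily` — THE CORE: over E0b's model/transport data, the local variable, the newform, the
  pin and the pinned `L`, the frames, (P) Kato's (KZ) family at the frame with `κK = q`, and a cusp family `δ ↦ (c, d, a, ee, d', D, μ̃)`
  (brick-B1 shape): GENUINE lifts `s δ` (`Kato2004.exists_isEulerSystemClassTwo_of_zetaBody`) with, for every `δ, n`, the socket's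
  levelwise congruence for `x δ := C(D δ) • s δ`, `A δ := C((N·q.num:ℤ))·μ̃ δ`, `d := q.den`, at the f-block's lift `g` — §1 + K3
  `KatoBK.charSumF_mul_gaussSum_eq_two` + E2c `SSFlatERL.katoTrivialValuesTwo_brick_of_frobeniusTrace` + C1 ★ `SSFlatCap.hE3_of_C6_family`
  at the level function `M n := cycLevel 2 (n+2) ∅` + C1 §1–§2 (lift transfer, class scaling).

References: [Kato2004Asterisque] K. Kato, Astérisque 295 (2004), Thm. 12.4–12.6 (pp. 221–222), Thm. 6.6 (1), Thm. 9.7, Ex. 13.3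
(p. 225), §13.9–13.14 (pp. 229–234); [Sprung2012] F. Sprung, J. Number Theory 132 (2012), Thm. 2.2, Def. 3.1, Def. 5.9, Def. 7.1,
Thm. 7.14, 7.16; [Sprung2017] Thm. 1.12, Cor. 4.4–4.5; [Kobayashi2003] Thm. 6.3, (8.23), Prop. 8.25–8.26; [BlochKato1990] §3
(3.10.1), (3.11); [MazurTateTeitelbaum1986Invent] §I.10, §I.13; [RohrlichInventiones1984] Theorem (p. 409).
-/

set_option autoImplicit false
-- the Theorems namespace of this sub repeats the summit name by design (D-0017 nested layout)
set_option linter.dupNamespace false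

noncomputable section

set_option backward.isDefEq.respectTransparency false

open scoped Classical MatrixGroups ModularForm NumberField TensorProduct

namespace Summit.BirchSwinnertonDyer.BirchSwinnertonDyer.Theorems.SSFlatCap

open CongruenceSubgroup WeierstrassCurve Field IsDedekindDomain NumberField Polynomial
  Literature.NumberTheory.GaloisRepresentations
  Literature.NumberTheory.EllipticCurves Literature.NumberTheory.EllipticCurves.ModularForms
  Literature.NumberTheory.EllipticCurves.Module Literature.NumberTheory.EllipticCurves.Rank1Residual
  Literature.NumberTheory.EllipticCurves.Kobayashi2003 Literature.NumberTheory.EllipticCurves.Kato2004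
  Literature.NumberTheory.EllipticCurves.Kato2004.EulerSystemValues Literature.NumberTheory.EllipticCurves.Sprung2012
  Literature.NumberTheory.EllipticCurves.Sprung2017
  Literature.NumberTheory.EllipticCurves.FormalGroupChart
  ZpExtension
  Summit.BirchSwinnertonDyer.Rank1Residual.Additive Summit.BirchSwinnertonDyer.Rank1Residual.Additive.PadicCyclotomicTower
  Summit.BirchSwinnertonDyer.Rank1Residual.Additive.BallEval
  Summit.BirchSwinnertonDyer.Rank1Residual.F1Sign2
  Summit.BirchSwinnertonDyer.BirchSwinnertonDyer.Theorems.SignedKatoOffTwo.LocalTwo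
  Summit.BirchSwinnertonDyer.BirchSwinnertonDyer.Theorems.SignedKatoOffTwo
  Summit.BirchSwinnertonDyer.BirchSwinnertonDyer.Theorems.SignedKatoOffTwo.KatoBK
  Summit.BirchSwinnertonDyer.BirchSwinnertonDyer.Theorems.SSFlatERL

/-! ## §1 The (N2) bridge: the (C6)-shaped values `hV` of the PINNED localisation `L` at a Kato lift, from the (KZ) clause -/

/-- The point `d₀ n = N•(y_{n+2} + σ•y_{n+2}) − 2•y_1` of the model lies in the formal group (its `toLoc`-preimage is in the
kernel of reduction), because the `y_m` do. [cite: Kobayashi2003, §8.4] [cite: Sprung2012, Thm. 2.2] -/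
theorem toLoc_symm_d₀_mem_kernel (W : WeierstrassCurve ℚ) [W.IsGloballyMinimal] {y : ℕ → localPoints W ℚ_[2]} {σ : ℕ → Field.absoluteGaloisGroup ℚ_[2]}
    {d₀ : ℕ → localPoints W ℚ_[2]} {N : ℕ}
    (hyker : haveI := isIntegral_genFib_baseChange 2 ((integralModelInt W).map (Int.castRingHom ℤ_[2]))
        ∀ m, (toLoc ((genFibΩ_eq_baseChange ((integralModelInt W).map (Int.castRingHom ℤ_[2]))).trans
              (baseChange_twoAdicModel W))).symm (y m) ∈
            kernel (Valued.v (R := PadicAlgCl 2)) (genFibΩ 2 ((integralModelInt W).map (Int.castRingHom ℤ_[2]))))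
    (hd₀ : ∀ n, d₀ n = N • (y (n + 2) + σ (n + 2) • y (n + 2)) - 2 • y 1) (n : ℕ) :
    haveI := isIntegral_genFib_baseChange 2 ((integralModelInt W).map (Int.castRingHom ℤ_[2]))
    (toLoc ((genFibΩ_eq_baseChange ((integralModelInt W).map (Int.castRingHom ℤ_[2]))).trans
      (baseChange_twoAdicModel W))).symm (d₀ n) ∈
        kernel (Valued.v (R := PadicAlgCl 2)) (genFibΩ 2 ((integralModelInt W).map (Int.castRingHom ℤ_[2]))) := by
  haveI hintΩ := isIntegral_genFib_baseChange 2 ((integralModelInt W).map (Int.castRingHom ℤ_[2]))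
  set hVm := (genFibΩ_eq_baseChange ((integralModelInt W).map (Int.castRingHom ℤ_[2]))).trans (baseChange_twoAdicModel W)
  set K := kernel (Valued.v (R := PadicAlgCl 2)) (genFibΩ 2 ((integralModelInt W).map (Int.castRingHom ℤ_[2])))
  have h1 : (toLoc hVm).symm (y (n + 2)) ∈ K := hyker (n + 2)
  have h2 : (toLoc hVm).symm (y 1) ∈ K := hyker 1
  have h3 : (toLoc hVm).symm (σ (n + 2) • y (n + 2)) ∈ K := @toLoc_symm_smul_mem_kernel W _ (σ (n + 2)) (y (n + 2)) @h1
  have h4 : N • ((toLoc hVm).symm (y (n + 2)) + (toLoc hVm).symm (σ (n + 2) • y (n + 2))) - 2 • (toLoc hVm).symm (y 1) ∈ K :=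
    K.sub_mem (K.nsmul_mem (K.add_mem @h1 @h3) N) (K.nsmul_mem @h2 2)
  rw [hd₀ n, map_sub, map_nsmul, map_nsmul, map_add]
  exact @h4

section Bridge

variable (W : WeierstrassCurve ℚ) [W.IsElliptic] [W.IsGloballyMinimal] [ContinuousSMul ℤ_[2] (W.tateModule 2)]
  {κ : ZpExtension ℚ 2} (hκ : κ.IsCyclotomic) {γ : Field.absoluteGaloisGroup ℚ} (v : HeightOneSpectrum (𝓞 ℚ))

/-- ★ **THE (N2) BRIDGE.**  For the frame `Φ : ℚ̄₂ ≅ \overline{ℚ_v}` with `closureEmb = Φ ∘ ι`, model points `d₀ n` in the formal group,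
their transports `c n = Φ(d₀ n) ∈ E(ℚ_{n,v})`, a model element `g₀` and a lift `g` with `Φ(g₀ʲ•P) = gʲ•Φ(P)`, the pin `I`, a localisation
`L : 𝐇¹ → (E(ℚ_∞·ℚ_v) →+ ℤ₂)` PINNED by the Tate-pairing residues (`toZModPow k (L x Q) = tatePairingPk n k (proj_n x) Q`, the f-block's
hypothesis on `L`), a class `s` whose layers are the corestrictions of Kato's `z_{2^{n+2}}` and the (KZ) clause for `(z, x)`
(`Kato2004.exists_eulerSystem_expStar_tatePairing_values_two`): the values of `L s` on the orbit `gʲ • c n` have the (C6) shape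
`ι(L s (gʲ c n)) = ∑_b τ_b • (Λ(T⁻¹(g₀ʲ d₀ n)) · e_{n+2}(x_{n+2}))` — E5's `hV`.  (`PadicInt.ext_of_toZModPow`, `toLoc_symm_mem_kernel_iff`,
`KatoBK.ptLogΩ_toLoc_symm_eq`; K3 `corePairChiPrim_of_coreKZ_of_bricks` step hV with `pair n (proj_n s)` replaced by the pinned `L`.)
[cite: Kato2004Asterisque, Thm. 12.5 (1) (p. 222), Ex. 13.3 (p. 225)] [cite: BlochKato1990, §3 (3.10.1), (3.11)] [cite: Kobayashi2003, (8.23), Prop. 8.25] -/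
theorem hV_of_KZ
    (Φ : AlgebraicClosure ℚ_[2] ≃ₐ[ℚ] AlgebraicClosure (v.adicCompletion ℚ))
    {y : ℕ → localPoints W ℚ_[2]} {σ : ℕ → Field.absoluteGaloisGroup ℚ_[2]} {d₀ : ℕ → localPoints W ℚ_[2]} {N : ℕ}
    (hyker : haveI := isIntegral_genFib_baseChange 2 ((integralModelInt W).map (Int.castRingHom ℤ_[2]))
        ∀ m, (toLoc ((genFibΩ_eq_baseChange ((integralModelInt W).map (Int.castRingHom ℤ_[2]))).trans
              (baseChange_twoAdicModel W))).symm (y m) ∈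
            kernel (Valued.v (R := PadicAlgCl 2)) (genFibΩ 2 ((integralModelInt W).map (Int.castRingHom ℤ_[2]))))
    (hd₀ : ∀ n, d₀ n = N • (y (n + 2) + σ (n + 2) • y (n + 2)) - 2 • y 1)
    {c : ℕ → localPoints W (v.adicCompletion ℚ)}
    (hc : ∀ m, c m = WeierstrassCurve.Affine.Point.map (W' := W)
        (Φ : AlgebraicClosure ℚ_[2] →ₐ[ℚ] AlgebraicClosure (v.adicCompletion ℚ))
        (show (W.baseChange (AlgebraicClosure ℚ_[2])).toAffine.Point from d₀ m))
    (hcL : ∀ m, c m ∈ localLayerPointsOfEmb κ (closureEmb (K := ℚ) (v.adicCompletion ℚ)) W m)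
    {g₀ : Field.absoluteGaloisGroup ℚ_[2]} {g : Field.absoluteGaloisGroup (v.adicCompletion ℚ)}
    (hTg : ∀ (j : ℕ) (P : localPoints W ℚ_[2]),
        (show localPoints W (v.adicCompletion ℚ) from
          WeierstrassCurve.Affine.Point.map (W' := W)
            (Φ : AlgebraicClosure ℚ_[2] →ₐ[ℚ] AlgebraicClosure (v.adicCompletion ℚ))
            (show (W.baseChange (AlgebraicClosure ℚ_[2])).toAffine.Point from (g₀ ^ j • P))) =
          g ^ j • (show localPoints W (v.adicCompletion ℚ) from
            WeierstrassCurve.Affine.Point.map (W' := W)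
              (Φ : AlgebraicClosure ℚ_[2] →ₐ[ℚ] AlgebraicClosure (v.adicCompletion ℚ))
              (show (W.baseChange (AlgebraicClosure ℚ_[2])).toAffine.Point from P)))
    (I : Kato2004.IwasawaH1Data W 2 κ γ)
    (L : I.H → (localTowerPointsOfEmb κ (closureEmb (K := ℚ) (v.adicCompletion ℚ)) W →+ ℤ_[2]))
    (hLpin : ∀ (x : I.H) (n k : ℕ) (Q : localPoints W (v.adicCompletion ℚ))
        (hQ : Q ∈ localLayerPointsOfEmb κ (closureEmb (K := ℚ) (v.adicCompletion ℚ)) W n),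
        PadicInt.toZModPow k (L x ⟨Q, localLayerPointsOfEmb_le_localTowerPointsOfEmb κ _ W n hQ⟩) =
          CyclotomicLayer.tatePairingPk W κ v n k (I.proj n x) ⟨Q, hQ⟩)
    (e : ∀ k : ℕ, CyclotomicField (cycLevel 2 k ∅) ℚ →ₐ[ℚ] PadicAlgCl 2)
    (τ : ∀ m : ℕ, ZMod (2 ^ m) → Field.absoluteGaloisGroup ℚ_[2])
    {cδ dδ : ℤ} {A : ℕ}
    {z : ∀ (k : ℕ) (r : (cyclotomicLevelsRat 2 (badPlaces cδ dδ A (W.conductorNorm ℤ))).Ideals),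
      H1 (tateRep W 2) ((cyclotomicLevelsRat 2 (badPlaces cδ dδ A (W.conductorNorm ℤ))).level k r.1)}
    {x : ∀ (k : ℕ) (r : (cyclotomicLevelsRat 2 (badPlaces cδ dδ A (W.conductorNorm ℤ))).Ideals),
      CyclotomicField (cycLevel 2 k r.1) ℚ}
    (hKZ : ∀ (n : ℕ) (Q₀ : localPoints W ℚ_[2])
      (hQv : WeierstrassCurve.Affine.Point.map (W' := W)
          (Φ : AlgebraicClosure ℚ_[2] →ₐ[ℚ] AlgebraicClosure (v.adicCompletion ℚ))
          (show (W.baseChange (AlgebraicClosure ℚ_[2])).toAffine.Point from Q₀) ∈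
        localLayerPointsOfEmb κ (closureEmb (K := ℚ) (v.adicCompletion ℚ)) W n),
      (∀ (X Y : AlgebraicClosure ℚ_[2]) (hXY : (W.baseChange (AlgebraicClosure ℚ_[2])).toAffine.Nonsingular X Y),
          (show (W.baseChange (AlgebraicClosure ℚ_[2])).toAffine.Point from Q₀) = .some X Y hXY → 1 < Valued.v X) →
      ∃ t : ℤ_[2],
        (∀ k : ℕ, CyclotomicLayer.tatePairingPk W κ v n k
            (levelToLayerTwo W hκ (∅ : Set (HeightOneSpectrum (𝓞 ℚ))) n
              (z (n + 2) (cyclotomicLevelsRat 2 (badPlaces cδ dδ A (W.conductorNorm ℤ))).idealOne))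
            ⟨_, hQv⟩ = PadicInt.toZModPow k t) ∧
        algebraMap ℚ_[2] (PadicAlgCl 2) (t : ℚ_[2]) =
          ∑ b : (ZMod (2 ^ (n + 2)))ˣ, τ (n + 2) (b : ZMod (2 ^ (n + 2))) •
            ((∑' i : ℕ, algebraMap ℚ_[2] (PadicAlgCl 2) (PowerSeries.coeff i (W.map (algebraMap ℚ ℚ_[2])).formalLog) *
                (WeierstrassCurve.Affine.Point.zCoord
                  (show (W.baseChange (AlgebraicClosure ℚ_[2])).toAffine.Point from Q₀)) ^ i) *
              e (n + 2) (x (n + 2) (cyclotomicLevelsRat 2 (badPlaces cδ dδ A (W.conductorNorm ℤ))).idealOne)))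
    {s : I.H}
    (hs : ∀ n : ℕ, I.proj n s = levelToLayerTwo W hκ (badPlaces cδ dδ A (W.conductorNorm ℤ)) n
      (z (n + 2) (cyclotomicLevelsRat 2 (badPlaces cδ dδ A (W.conductorNorm ℤ))).idealOne))
    (n j : ℕ) :
    haveI := isIntegral_genFib_baseChange 2 ((integralModelInt W).map (Int.castRingHom ℤ_[2]))
    algebraMap ℚ_[2] (PadicAlgCl 2)
        (evalOn W (localTowerPointsOfEmb κ (closureEmb (K := ℚ) (v.adicCompletion ℚ)) W) (L s) (g ^ j • c n) : ℚ_[2]) =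
      ∑ b : (ZMod (2 ^ (n + 2)))ˣ, τ (n + 2) (b : ZMod (2 ^ (n + 2))) •
        (ptLogΩ 2 ((integralModelInt W).map (Int.castRingHom ℤ_[2]))
          ((toLoc ((genFibΩ_eq_baseChange ((integralModelInt W).map (Int.castRingHom ℤ_[2]))).trans
            (baseChange_twoAdicModel W))).symm (g₀ ^ j • d₀ n)) *
          e (n + 2) (x (n + 2) (cyclotomicLevelsRat 2 (badPlaces cδ dδ A (W.conductorNorm ℤ))).idealOne)) := by
  haveI hintΩ := isIntegral_genFib_baseChange 2 ((integralModelInt W).map (Int.castRingHom ℤ_[2]))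
  -- the point `g₀ʲ • d₀ n` of the model is formal, and transports to `gʲ • c n ∈ E(ℚ_{n,v})`
  have hk0 := @toLoc_symm_d₀_mem_kernel W _ y σ d₀ N hyker hd₀ n
  have hkj : (toLoc ((genFibΩ_eq_baseChange ((integralModelInt W).map (Int.castRingHom ℤ_[2]))).trans
      (baseChange_twoAdicModel W))).symm (g₀ ^ j • d₀ n) ∈
        kernel (Valued.v (R := PadicAlgCl 2)) (genFibΩ 2 ((integralModelInt W).map (Int.castRingHom ℤ_[2]))) :=
    @toLoc_symm_smul_mem_kernel W _ (g₀ ^ j) (d₀ n) @hk0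
  have hmemL : g ^ j • c n ∈ localLayerPointsOfEmb κ (closureEmb (K := ℚ) (v.adicCompletion ℚ)) W n :=
    smul_mem_localLayerPointsOfEmb κ (closureEmb (K := ℚ) (v.adicCompletion ℚ)) W n (g ^ j) (hcL n)
  have hmemT : g ^ j • c n ∈ localTowerPointsOfEmb κ (closureEmb (K := ℚ) (v.adicCompletion ℚ)) W :=
    localLayerPointsOfEmb_le_localTowerPointsOfEmb κ (closureEmb (K := ℚ) (v.adicCompletion ℚ)) W n hmemL
  have hpt : (show localPoints W (v.adicCompletion ℚ) from
      WeierstrassCurve.Affine.Point.map (W' := W)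
        (Φ : AlgebraicClosure ℚ_[2] →ₐ[ℚ] AlgebraicClosure (v.adicCompletion ℚ))
        (show (W.baseChange (AlgebraicClosure ℚ_[2])).toAffine.Point from (g₀ ^ j • d₀ n))) = g ^ j • c n := by
    have h := hTg j (d₀ n)
    have h' := hc n
    dsimp only at h h' ⊢
    rw [h, h']
  have hQv : WeierstrassCurve.Affine.Point.map (W' := W)
        (Φ : AlgebraicClosure ℚ_[2] →ₐ[ℚ] AlgebraicClosure (v.adicCompletion ℚ))
        (show (W.baseChange (AlgebraicClosure ℚ_[2])).toAffine.Point from (g₀ ^ j • d₀ n)) ∈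
      localLayerPointsOfEmb κ (closureEmb (K := ℚ) (v.adicCompletion ℚ)) W n := by
    have h := hpt
    dsimp only at h
    rw [h]
    exact hmemL
  have hformal := (toLoc_symm_mem_kernel_iff (W := W)
    ((genFibΩ_eq_baseChange ((integralModelInt W).map (Int.castRingHom ℤ_[2]))).trans (baseChange_twoAdicModel W))
    (g₀ ^ j • d₀ n)).mp hkj
  obtain ⟨t, ht, htval⟩ := hKZ n (g₀ ^ j • d₀ n) hQv hformal
  -- `L s (gʲ • c n) = t` from the residues (the pin) and `proj_n s = Cor z_{2^{n+2}}`
  have hsub : (⟨g ^ j • c n, hmemL⟩ : localLayerPointsOfEmb κ (closureEmb (K := ℚ) (v.adicCompletion ℚ)) W n) = ⟨_, hQv⟩ :=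
    Subtype.ext hpt.symm
  have hproj : I.proj n s = levelToLayerTwo W hκ (∅ : Set (HeightOneSpectrum (𝓞 ℚ))) n
      (z (n + 2) (cyclotomicLevelsRat 2 (badPlaces cδ dδ A (W.conductorNorm ℤ))).idealOne) := hs n
  have hLt : L s ⟨g ^ j • c n, hmemT⟩ = t := by
    refine PadicInt.ext_of_toZModPow.mp fun k ↦ ?_
    rw [hLpin s n k (g ^ j • c n) hmemL, hsub, hproj, ht k]
  rw [evalOn_of_mem W _ _ hmemT, hLt, htval, ptLogΩ_toLoc_symm_eq]

end Bridge

/-! ## §2 THE CORE: the socket's levelwise congruences for the family of record, from the displayed Kato family and cusp family -/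

section Core

variable (W : WeierstrassCurve ℚ) [W.IsElliptic] [W.IsGloballyMinimal] [ContinuousSMul ℤ_[2] (W.tateModule 2)]
  [Module.Free ℤ_[2] (W.tateModule 2)] [Module.Finite ℤ_[2] (W.tateModule 2)]
  {κ : ZpExtension ℚ 2} (hκ : κ.IsCyclotomic) {γ : Field.absoluteGaloisGroup ℚ} (v : HeightOneSpectrum (𝓞 ℚ))

/-- ★★ **THE CORE OF THE CAPSTONE: Kato's lifts and their levelwise congruences, for the family of record.**  Displayed: the habitat
`GoodSS W 2`; E0b's frame `Φ` (with `closureEmb = Φ ∘ ι`) and Sprung–Honda MODEL data (`x, y, σ, N, d₀` with their clauses), the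
TRANSPORT `c n = Φ(d₀ n)` of the system to `ℚ_v` with its levels and trace relation; the local variable `g₀` on the model with its lift
`g₁` (`Φ(g₀ʲ•P) = g₁ʲ•Φ P`, `LocalVar.exists_localVariable_two`) and the f-block's lift `g`; the newform `f` of `W`; the pin `I` and the
localisation `L` (`Λ`-linear for `g`) PINNED by the Tate-pairing residues; the `2`-adic frame `(e, τ)` and the standard complex frame `ιC`;
(P) KATO'S (KZ) FAMILY AT THIS FRAME — `κK = q ∈ ℚ`, `ΛK`, and for all admissible `(c, d, a, A)` classes `z` and values `x` with
`ZetaBody` (C1)–(C5) and the (KZ) pairing law (the body of `Kato2004.exists_eulerSystem_expStar_tatePairing_values_two`); and a CUSP FAMILY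
`δ ↦ (c, d, a, ee, d', D, μ̃)` with Kato's guards and the cusp-multiplier law (the conclusion shape of `KatoBK.cuspBrick_of_isNewformOf`).
Conclusion: GENUINE classes `s δ ∈ 𝐇¹_Γ(T₂W)` (Kato's Λ-adic lifts) such that for every `δ`, `n`:
`∃ m q', C(2^m)·(ι(C((N·q.num:ℤ))·μ̃ δ)·θ̃_n − ι(C(q.den)·P^{g}_{n,c_n}(L (C(D δ) • s δ)))) = ι(ω_n q')` — the socket's `hE3` for
`x δ := C(D δ) • s δ`, `A δ := C((N·q.num:ℤ))·μ̃ δ`, `d := q.den`.  Assembly: §1 (hV) + K3 `KatoBK.charSumF_mul_gaussSum_eq_two` (hB2) + E2c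
`SSFlatERL.katoTrivialValuesTwo_brick_of_frobeniusTrace` (hB4c) + C1 ★ `hE3_of_C6_family` at `M n := cycLevel 2 (n+2) ∅` + C1 §1–§2.
[cite: Kato2004Asterisque, Thm. 12.5 (1), Thm. 6.6 (1), Thm. 9.7, Ex. 13.3 (p. 225), §13.9] [cite: Kobayashi2003, (8.23), Prop. 8.25–8.26]
[cite: Sprung2012, Thm. 2.2, Def. 3.1, Props. 6.3–6.5] [cite: MazurTateTeitelbaum1986Invent, §I.10, §I.13] -/
theorem exists_lifts_levelCongruences_of_katoFamily (hss : GoodSS W 2)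
    -- E0b's frame and model data
    (Φ : AlgebraicClosure ℚ_[2] ≃ₐ[ℚ] AlgebraicClosure (v.adicCompletion ℚ)) (ι : AlgebraicClosure ℚ →ₐ[ℚ] AlgebraicClosure ℚ_[2])
    {x : ℕ → ℚ_[2]} {y : ℕ → localPoints W ℚ_[2]} {σ : ℕ → Field.absoluteGaloisGroup ℚ_[2]} {d₀ : ℕ → localPoints W ℚ_[2]} {N : ℕ}
    (hx0 : x 0 = 1) (hx1 : (2 : ℚ_[2]) * x 1 = W.frobeniusTrace 2)
    (hx2 : (2 : ℚ_[2]) * x 2 = W.frobeniusTrace 2 * x 1 - x 0) (hN : (N : ℤ) = 3 - W.frobeniusTrace 2)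
    (hyΩ : haveI := isIntegral_genFib_baseChange 2 ((integralModelInt W).map (Int.castRingHom ℤ_[2]))
        ∀ m, (toLoc ((genFibΩ_eq_baseChange ((integralModelInt W).map (Int.castRingHom ℤ_[2]))).trans
              (baseChange_twoAdicModel W))).symm (y m) ∈
            subfieldPoints (genFibΩ 2 ((integralModelInt W).map (Int.castRingHom ℤ_[2]))) (layer 2 m).toSubfield
              coeffs_mem_layer ∧
          (toLoc ((genFibΩ_eq_baseChange ((integralModelInt W).map (Int.castRingHom ℤ_[2]))).trans
              (baseChange_twoAdicModel W))).symm (y m) ∈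
            kernel (Valued.v (R := PadicAlgCl 2)) (genFibΩ 2 ((integralModelInt W).map (Int.castRingHom ℤ_[2]))) ∧
          ptLogΩ 2 ((integralModelInt W).map (Int.castRingHom ℤ_[2]))
            ((toLoc ((genFibΩ_eq_baseChange ((integralModelInt W).map (Int.castRingHom ℤ_[2]))).trans
              (baseChange_twoAdicModel W))).symm (y m)) =
            ∑ k ∈ Finset.range m, algebraMap ℚ_[2] (PadicAlgCl 2) (x k) * (zeta 2 (m - k) - 1))
    (hystab : ∀ m, ∀ τ ∈ stab 2 m, τ • y m = y m)
    (hσ : ∀ m, 1 ≤ m → σ m • zeta 2 m = (zeta 2 m)⁻¹)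
    (hd₀ : ∀ n, d₀ n = N • (y (n + 2) + σ (n + 2) • y (n + 2)) - 2 • y 1)
    (hL₀ : ∀ m, d₀ m ∈ localLayerPointsOfEmb κ ι W m)
    -- the transport of the system to `ℚ_v`
    {c : ℕ → localPoints W (v.adicCompletion ℚ)}
    (hc : ∀ m, c m = WeierstrassCurve.Affine.Point.map (W' := W)
        (Φ : AlgebraicClosure ℚ_[2] →ₐ[ℚ] AlgebraicClosure (v.adicCompletion ℚ))
        (show (W.baseChange (AlgebraicClosure ℚ_[2])).toAffine.Point from d₀ m))
    (hcL : ∀ m, c m ∈ localLayerPointsOfEmb κ (closureEmb (K := ℚ) (v.adicCompletion ℚ)) W m)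
    (hTR : ∀ n, localTraceOfEmb κ (closureEmb (K := ℚ) (v.adicCompletion ℚ)) W (n + 1) (n + 2) (c (n + 2)) =
      W.frobeniusTrace 2 • c (n + 1) - c n)
    -- the local variable on the model, its lift `g₁`, and the f-block's lift `g`
    {g₀ : Field.absoluteGaloisGroup ℚ_[2]} (hg₀ : ∀ m j : ℕ, g₀ ^ j • zeta 2 m = zeta 2 m ^ 5 ^ j)
    {g₁ g : Field.absoluteGaloisGroup (v.adicCompletion ℚ)}
    (hg₁ : κ.IsTopGenerator (resGalOfEmb (closureEmb (K := ℚ) (v.adicCompletion ℚ)) g₁))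
    (hg : κ.IsTopGenerator (resGalOfEmb (closureEmb (K := ℚ) (v.adicCompletion ℚ)) g))
    (hTg : ∀ (j : ℕ) (P : localPoints W ℚ_[2]),
        (show localPoints W (v.adicCompletion ℚ) from
          WeierstrassCurve.Affine.Point.map (W' := W)
            (Φ : AlgebraicClosure ℚ_[2] →ₐ[ℚ] AlgebraicClosure (v.adicCompletion ℚ))
            (show (W.baseChange (AlgebraicClosure ℚ_[2])).toAffine.Point from (g₀ ^ j • P))) =
          g₁ ^ j • (show localPoints W (v.adicCompletion ℚ) from
            WeierstrassCurve.Affine.Point.map (W' := W)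
              (Φ : AlgebraicClosure ℚ_[2] →ₐ[ℚ] AlgebraicClosure (v.adicCompletion ℚ))
              (show (W.baseChange (AlgebraicClosure ℚ_[2])).toAffine.Point from P)))
    -- the newform, the pin, the pinned localisation
    [NeZero (W.conductorNorm ℤ)] (f : CuspForm (Gamma0 (W.conductorNorm ℤ)) 2) (hf : IsNewformOf W f)
    (I : Kato2004.IwasawaH1Data W 2 κ γ)
    (L : letI := moduleOfGenerator κ (closureEmb (K := ℚ) (v.adicCompletion ℚ)) W hg
      I.H →ₗ[IwasawaAlgebra 2] (localTowerPointsOfEmb κ (closureEmb (K := ℚ) (v.adicCompletion ℚ)) W →+ ℤ_[2]))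
    (hLpin : ∀ (x : I.H) (n k : ℕ) (Q : localPoints W (v.adicCompletion ℚ))
        (hQ : Q ∈ localLayerPointsOfEmb κ (closureEmb (K := ℚ) (v.adicCompletion ℚ)) W n),
        PadicInt.toZModPow k (L x ⟨Q, localLayerPointsOfEmb_le_localTowerPointsOfEmb κ _ W n hQ⟩) =
          CyclotomicLayer.tatePairingPk W κ v n k (I.proj n x) ⟨Q, hQ⟩)
    -- the frames
    (e : ∀ k : ℕ, CyclotomicField (cycLevel 2 k ∅) ℚ →ₐ[ℚ] PadicAlgCl 2)
    (he : ∀ k, e k (IsCyclotomicExtension.zeta (cycLevel 2 k ∅) ℚ (CyclotomicField (cycLevel 2 k ∅) ℚ)) = zeta 2 k)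
    (τ : ∀ m : ℕ, ZMod (2 ^ m) → Field.absoluteGaloisGroup ℚ_[2])
    (hτ : ∀ (m : ℕ) (a : ZMod (2 ^ m)), IsUnit a → τ m a • zeta 2 m = zeta 2 m ^ a.val)
    (ιC : (m : ℕ) → (CyclotomicField m ℚ →+* ℂ))
    (hιC : ∀ k : ℕ, ιC (cycLevel 2 k ∅) (IsCyclotomicExtension.zeta (cycLevel 2 k ∅) ℚ (CyclotomicField (cycLevel 2 k ∅) ℚ)) =
      Complex.exp (2 * Real.pi * Complex.I / (cycLevel 2 k ∅ : ℕ)))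
    -- (P) Kato's (KZ) family at this frame, with its constant
    {κK : ℝ} {q : ℚ} (hq : κK = q)
    (ΛK : ∀ (k : ℕ) (r : Finset (HeightOneSpectrum (𝓞 ℚ))),
      H1 (tateRep W 2) (cycSubgroup 2 k r) →ₗ[ℤ_[2]] ℚ_[2] ⊗[ℚ] CyclotomicField (cycLevel 2 k r) ℚ)
    (hfam : ∀ (c d a : ℤ) (A : ℕ), 0 < A → Int.gcd c (6 * 2 * A) = 1 → Int.gcd d (6 * 2 * W.conductorNorm ℤ) = 1 →
      ∃ (z : ∀ (k : ℕ) (r : (cyclotomicLevelsRat 2 (badPlaces c d A (W.conductorNorm ℤ))).Ideals),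
            H1 (tateRep W 2) ((cyclotomicLevelsRat 2 (badPlaces c d A (W.conductorNorm ℤ))).level k r.1))
        (x : ∀ (k : ℕ) (r : (cyclotomicLevelsRat 2 (badPlaces c d A (W.conductorNorm ℤ))).Ideals),
            CyclotomicField (cycLevel 2 k r.1) ℚ),
        ZetaBody W 2 f ιC κK ΛK c d a A z x ∧
        ∀ (n : ℕ) (Q₀ : localPoints W ℚ_[2])
          (hQv : WeierstrassCurve.Affine.Point.map (W' := W)
              (Φ : AlgebraicClosure ℚ_[2] →ₐ[ℚ] AlgebraicClosure (v.adicCompletion ℚ))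
              (show (W.baseChange (AlgebraicClosure ℚ_[2])).toAffine.Point from Q₀) ∈
            localLayerPointsOfEmb κ (closureEmb (K := ℚ) (v.adicCompletion ℚ)) W n),
          (∀ (X Y : AlgebraicClosure ℚ_[2]) (hXY : (W.baseChange (AlgebraicClosure ℚ_[2])).toAffine.Nonsingular X Y),
              (show (W.baseChange (AlgebraicClosure ℚ_[2])).toAffine.Point from Q₀) = .some X Y hXY → 1 < Valued.v X) →
          ∃ t : ℤ_[2],
            (∀ k : ℕ, CyclotomicLayer.tatePairingPk W κ v n k
                (levelToLayerTwo W hκ (∅ : Set (HeightOneSpectrum (𝓞 ℚ))) n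
                  (z (n + 2) (cyclotomicLevelsRat 2 (badPlaces c d A (W.conductorNorm ℤ))).idealOne))
                ⟨_, hQv⟩ = PadicInt.toZModPow k t) ∧
            algebraMap ℚ_[2] (PadicAlgCl 2) (t : ℚ_[2]) =
              ∑ b : (ZMod (2 ^ (n + 2)))ˣ, τ (n + 2) (b : ZMod (2 ^ (n + 2))) •
                ((∑' i : ℕ, algebraMap ℚ_[2] (PadicAlgCl 2) (PowerSeries.coeff i (W.map (algebraMap ℚ ℚ_[2])).formalLog) *
                    (WeierstrassCurve.Affine.Point.zCoord
                      (show (W.baseChange (AlgebraicClosure ℚ_[2])).toAffine.Point from Q₀)) ^ i) *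
                  e (n + 2) (x (n + 2) (cyclotomicLevelsRat 2 (badPlaces c d A (W.conductorNorm ℤ))).idealOne)))
    -- the cusp family
    {Δ : Type*} (cδ dδ aδ : Δ → ℤ) (eeδ : Δ → ℕ) (dδ' Dδ : Δ → ℤ) (μt : Δ → IwasawaAlgebra 2)
    (hgc : ∀ δ, Int.gcd (cδ δ) (6 * 2 * 2 ^ eeδ δ) = 1) (hgd : ∀ δ, Int.gcd (dδ δ) (6 * 2 * W.conductorNorm ℤ) = 1)
    (hdd' : ∀ δ, dδ δ * dδ' δ ≡ 1 [ZMOD ((2 ^ eeδ δ : ℕ) : ℤ)])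
    (hμt : ∀ (δ : Δ) (n : ℕ) (χ : DirichletCharacter ℂ_[2] (2 ^ (n + 2))), χ.Even → (∃ j : ℕ, orderOf χ = 2 ^ j) →
      HasSum (fun k ↦ ((algebraMap ℚ_[2] ℂ_[2]).comp (algebraMap ℤ_[2] ℚ_[2])) (PowerSeries.coeff k (μt δ)) *
          (χ (5 : ZMod (2 ^ (n + 2))) - 1) ^ k)
        ((Dδ δ : ℂ_[2]) * ((cδ δ : ℂ_[2]) ^ 2 * (dδ δ : ℂ_[2]) ^ 2 *
            ((ratMinusSymbol f ((aδ δ : ℚ) / (2 ^ eeδ δ : ℕ)) : ℚ) : ℂ_[2])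
          - (cδ δ : ℂ_[2]) * (dδ δ : ℂ_[2]) ^ 2 * χ (cδ δ : ZMod (2 ^ (n + 2))) *
              ((ratMinusSymbol f ((aδ δ * cδ δ : ℚ) / (2 ^ eeδ δ : ℕ)) : ℚ) : ℂ_[2])
          - (cδ δ : ℂ_[2]) ^ 2 * (dδ δ : ℂ_[2]) * χ (dδ δ : ZMod (2 ^ (n + 2))) *
              ((ratMinusSymbol f ((aδ δ * dδ' δ : ℚ) / (2 ^ eeδ δ : ℕ)) : ℚ) : ℂ_[2])
          + (cδ δ : ℂ_[2]) * (dδ δ : ℂ_[2]) * (χ (cδ δ : ZMod (2 ^ (n + 2))) * χ (dδ δ : ZMod (2 ^ (n + 2)))) *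
              ((ratMinusSymbol f ((aδ δ * cδ δ * dδ' δ : ℚ) / (2 ^ eeδ δ : ℕ)) : ℚ) : ℂ_[2])))) :
    ∃ s : Δ → I.H, (∀ δ, Literature.NumberTheory.EllipticCurves.Kato2004.IsEulerSystemClassTwo W hκ I (s δ)) ∧
      ∀ (δ : Δ) (n : ℕ), ∃ (m : ℕ) (q' : IwasawaAlgebra 2),
        PowerSeries.C ((2 : ℚ_[2]) ^ m) *
            (iwasawaToPowerSeries 2 (PowerSeries.C ((((N : ℤ) * q.num : ℤ) : ℤ_[2])) * μt δ) *
                (((mazurTateElement f 2 n).map (algebraMap ℚ ℚ_[2]) : ℚ_[2][X]) : PowerSeries ℚ_[2]) -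
              iwasawaToPowerSeries 2 (PowerSeries.C ((q.den : ℤ) : ℤ_[2]) *
                pairingSum W (localTowerPointsOfEmb κ (closureEmb (K := ℚ) (v.adicCompletion ℚ)) W) g n (c n)
                  (L ((PowerSeries.C ((Dδ δ : ℤ) : ℤ_[2]) : IwasawaAlgebra 2) • s δ)))) =
          iwasawaToPowerSeries 2 ((((cyclotomicOmega 2 n).map (Int.castRingHom ℤ_[2]) : ℤ_[2][X]) : PowerSeries ℤ_[2]) * q') := by
  letI := moduleOfGenerator κ (closureEmb (K := ℚ) (v.adicCompletion ℚ)) W hg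
  -- Kato's family at the cusp data, and its Λ-adic lifts
  choose zf xf hbody hKZ using fun δ ↦ hfam (cδ δ) (dδ δ) (aδ δ) (2 ^ eeδ δ) (pow_pos two_pos _) (hgc δ) (hgd δ)
  have hne : ∀ δ, 2 * (cδ δ).natAbs * (dδ δ).natAbs * 2 ^ eeδ δ * W.conductorNorm ℤ ≠ 0 := fun δ ↦
    level_ne_zero (W.conductorNorm ℤ) (eeδ δ) (hgc δ) (hgd δ)
  choose s hES hs using fun δ ↦ Kato2004.exists_isEulerSystemClassTwo_of_zetaBody W hκ I f ιC κK ΛK (cδ δ) (dδ δ) (aδ δ)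
    (2 ^ eeδ δ) (zf δ) (xf δ) (hbody δ) (hne δ)
  refine ⟨s, hES, fun δ n ↦ ?_⟩
  -- bookkeeping
  have hf0 : IsNewform0 f := hf.1
  have hQ : coeffField f = ⊥ := hf.coeffField_eq_bot
  have h2N : ¬ 2 ∣ W.conductorNorm ℤ := not_dvd_level_of_isNewformOf hf hss.1
  have ha : cuspCoeff f 2 = ((W.frobeniusTrace 2 : ℤ) : ℂ) := cuspCoeff_eq_frobeniusTrace_of_isNewformOf_holds hf hss.1
  have hcodd : ∀ δ, ¬ (2 : ℤ) ∣ cδ δ := fun δ ↦ not_two_dvd_of_gcd_eq_one (hgc δ)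
  have hdodd : ∀ δ, ¬ (2 : ℤ) ∣ dδ δ := fun δ ↦ not_two_dvd_of_gcd_eq_one (hgd δ)
  have hM : ∀ n : ℕ, cycLevel 2 (n + 2) (∅ : Finset (HeightOneSpectrum (𝓞 ℚ))) = 2 ^ (n + 2) := fun n ↦ cycLevel_two_empty (n + 2)
  have hcT : ∀ m, c m ∈ localTowerPointsOfEmb κ (closureEmb (K := ℚ) (v.adicCompletion ℚ)) W := fun m ↦
    localLayerPointsOfEmb_le_localTowerPointsOfEmb κ _ W m (hcL m)
  have hA : ∀ n j : ℕ, g₁ ^ j • c n ∈ localTowerPointsOfEmb κ (closureEmb (K := ℚ) (v.adicCompletion ℚ)) W := fun n j ↦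
    smul_mem_localTowerPointsOfEmb κ _ W (g₁ ^ j) (hcT n)
  -- hV (§1), hB2 (K3), hB4c (E2c) per member and level
  have hV := fun (δ : Δ) (n j : ℕ) ↦ hV_of_KZ W hκ v Φ (fun m ↦ (hyΩ m).2.1) hd₀ hc hcL hTg I (fun x ↦ L x) hLpin e τ
    (hKZ δ) (hs δ) n j
  obtain ⟨m, q', h⟩ := hE3_of_C6_family W hκ ι (M := fun n ↦ cycLevel 2 (n + 2) (∅ : Finset (HeightOneSpectrum (𝓞 ℚ)))) hM
    hx0 hx1 hx2 hN hyΩ hystab hσ hd₀ hL₀ hg₀ (closureEmb (K := ℚ) (v.adicCompletion ℚ)) hg₁ hcL hTR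
    (localTowerPointsOfEmb κ (closureEmb (K := ℚ) (v.adicCompletion ℚ)) W) hA (fun n ↦ e (n + 2)) (fun n ↦ he (n + 2))
    (fun n ↦ τ (n + 2)) (fun n b hb ↦ hτ (n + 2) b hb) f hf0 hQ h2N ha q (fun δ ↦ L (s δ))
    (fun δ n ↦ xf δ (n + 2) (cyclotomicLevelsRat 2 (badPlaces (cδ δ) (dδ δ) (2 ^ eeδ δ) (W.conductorNorm ℤ))).idealOne) hV
    cδ dδ hcodd hdodd (fun δ ↦ ratMinusSymbol f ((aδ δ : ℚ) / (2 ^ eeδ δ : ℕ)))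
    (fun δ ↦ ratMinusSymbol f ((aδ δ * cδ δ : ℚ) / (2 ^ eeδ δ : ℕ)))
    (fun δ ↦ ratMinusSymbol f ((aδ δ * dδ' δ : ℚ) / (2 ^ eeδ δ : ℕ)))
    (fun δ ↦ ratMinusSymbol f ((aδ δ * cδ δ * dδ' δ : ℚ) / (2 ^ eeδ δ : ℕ)))
    (fun δ n ↦ charSumF_mul_gaussSum_eq_two hf (hbody δ) hq (hcodd δ) (hdodd δ) (dδ' δ) (hdd' δ) (hιC (n + 2)))
    (fun δ n hn ↦ katoTrivialValuesTwo_brick_of_frobeniusTrace W hss rfl f hf (hbody δ) hq rfl (dδ' δ) (hdd' δ) (n + 2)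
      (by omega) (by omega) (gcd_mul_cycLevel_mul_pow_eq_one (hcodd δ) (hdodd δ) (n + 2) (eeδ δ)))
    Dδ μt hμt δ n
  -- the normalisation of record: the lift `g`, the class `C(D δ) • s δ`, the denominator `q.den`
  refine ⟨m, q', levelCongruence_congr h ?_⟩
  rw [pairingSum_eq_of_isTopGenerator κ (closureEmb (K := ℚ) (v.adicCompletion ℚ)) W hg hg₁ _ n (hcT n),
    pairingSum_map_C_smul κ (closureEmb (K := ℚ) (v.adicCompletion ℚ)) W hg L, ← mul_assoc, ← map_mul, Int.cast_mul,
    mul_comm ((Dδ δ : ℤ) : ℤ_[2])]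

end Core

end Summit.BirchSwinnertonDyer.BirchSwinnertonDyer.Theorems.SSFlatCap

end
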